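import Mathlib
import HarnessLib
import Summits.CriticalPhenomena.CardyFormulaZ2.Theses.CardySelfDualSegment
import Literature.Probability.Percolation.CornerPercolation
import Literature.Analysis.Complex.CauchyTaylorBall
import Summits.CriticalPhenomena.CardyFormulaZ2.Theorems.CardySelfDualSegmentSegmentOpenStubCrossingProbPolynomial
import Summits.CriticalPhenomena.CardyFormulaZ2.Theorems.CardySelfDualSegmentSegmentOpenStubUniformComplexBoundOfSmallMesh
import Summits.CriticalPhenomena.CardyFormulaZ2.Theorems.CardySelfDualSegmentSegmentOpenStubGoodSetNhdsZeroOfJets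
import Summits.CriticalPhenomena.CardyFormulaZ2.Theorems.CardySelfDualSegmentUniformMarginalityDefs3

/-!
# Crux `SegmentOpen` (stmt-CriticalPhenomena-5471), line `Sketch`:
# stub S4w `stub_localComplexBound` — the Cauchy-estimate census links

Worker file (lead c5, wave 1, stub S4w).  The stub itself,

  `stub_localComplexBound : ∀ t₀ R, ∃ r > 0, ∃ δ₁ > 0, ∃ C, ∀ δ, 0 < δ → δ < δ₁ → ∀ p, (spec) →
     ∀ z ∈ B(t₀, r), ‖p(z)‖ ≤ C`

(LOCAL UNIFORM-IN-MESH ANALYTICITY of the crossing polynomials of S1), is research content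
(Lee–Yang type, non-perturbative) and is NOT proved here.  This file kernel-checks the census
entries around it, with the stub statement taken VERBATIM AS A HYPOTHESIS (never claimed):

* `russoCoeffBound_of_localComplexBound` (NECESSITY, Cauchy's estimate): S4w ⇒ δ-uniform
  GEOMETRIC DECAY of ALL Taylor coefficients of the complex crossing polynomial at `t₀`,
  `‖coeff_k (taylor t₀ p_δ)‖ · r^k ≤ C` (radius `r/2` of the stub's radius;
  `coeff_k (taylor t₀ p_δ)` = the signed level-`k` Fourier–Walsh sum of the coin-averaged crossing
  function at `t₀`);
* `localComplexBound_of_russoCoeffBound` (SUFFICIENCY, geometric series): the coefficient form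
  implies S4w back (radius `r/2`, bound `2C`) — so S4w IS its coefficient form
  ("LevelSumGeometricBound" of lead c4, pointwise in `(t₀, R)`);
* `russoBound_of_localComplexBound` (LEVEL ONE): S4w ⇒ the open research stub `RussoBound` of the
  sibling crux `UniformMarginality` (stmt-CriticalPhenomena-5472): `|∂_t P_t(R, δ)| ≤ C` locally in
  `t`, uniformly in the mesh (Cauchy's estimate for the first derivative on `B(t, r/2) ⊆ B(t₀, r)`
  at small mesh, the landed `russoBound_largeMesh` at large mesh);
* `uniformMarginality_of_localComplexBound`: hence S4w ⇒ the ROUTE DECL `UniformMarginality`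
  (crux 5472) through the landed heat-flow glue (`integratedBound_of`, `stub_russoIdentity`,
  `stub_pextContinuous`, `uniformMarginality_of_integratedBound`) — the pointwise weakening S4w of
  reshape 7 is still at least as hard as crux 5472 (reshape-6 record: S4s ⊢ UM, p131349).

Blocker for the stub: its level-`1` content at `t₀` is `RussoBoundAt R t₀` (open); no tree fact
supplies even that.
-/

noncomputable section

namespace Summit.CriticalPhenomena.CardyFormulaZ2.Theorems

open Literature.Probability Literature.Barriers.CriticalPhenomena
open Literature.Probability.RandomPlanarGeometry (ConformalRectangle ConformalEquiv MarkedDomain)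
open Filter Set Topology MeasureTheory
open UpperHalfPlane (upperHalfPlaneSet)

namespace LocalComplexBound

/-- `k! · coeff_k (taylor c q) = (derivative^[k] q)(c)` (Hasse derivatives). -/
theorem factorial_mul_taylor_coeff (q : Polynomial ℂ) (c : ℂ) (k : ℕ) :
    (k.factorial : ℂ) * (Polynomial.taylor c q).coeff k =
      (Polynomial.derivative^[k] q).eval c := by
  have h := congrFun (Polynomial.factorial_smul_hasseDeriv (R := ℂ) k) q
  rw [LinearMap.smul_apply] at h
  rw [← h, Polynomial.taylor_coeff, ← nsmul_eq_mul, Polynomial.eval_smul]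

/-- The `k`-th complex derivative of a polynomial function at `c` is `k! · coeff_k (taylor c q)`. -/
theorem iteratedDeriv_eval_eq_taylor_coeff (q : Polynomial ℂ) (c : ℂ) (k : ℕ) :
    iteratedDeriv k (fun z => q.eval z) c =
      (k.factorial : ℂ) * (Polynomial.taylor c q).coeff k := by
  rw [GoodSetNhdsZeroOfJets.iteratedDeriv_eval, factorial_mul_taylor_coeff]

/-- **Cauchy's estimate for Taylor coefficients of a polynomial**: if `‖q‖ ≤ M` on the disc
`B(c, R)`, then `‖coeff_k (taylor c q)‖ · (R/2)^k ≤ M` for every `k`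
(`Literature.Analysis.Complex.norm_iteratedDeriv_le_of_forall_mem_ball`). -/
theorem norm_taylor_coeff_mul_pow_le {q : Polynomial ℂ} {c : ℂ} {R M : ℝ} (hR : 0 < R)
    (hM : ∀ z ∈ Metric.ball c R, ‖q.eval z‖ ≤ M) (k : ℕ) :
    ‖(Polynomial.taylor c q).coeff k‖ * (R / 2) ^ k ≤ M := by
  have hd : DifferentiableOn ℂ (fun z => q.eval z) (Metric.ball c R) :=
    (Polynomial.differentiable q).differentiableOn
  have h := Literature.Analysis.Complex.norm_iteratedDeriv_le_of_forall_mem_ball hR hd hM k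
  rw [iteratedDeriv_eval_eq_taylor_coeff, norm_mul, Complex.norm_natCast, mul_div_assoc] at h
  have hk : (0 : ℝ) < k.factorial := by exact_mod_cast k.factorial_pos
  have hR2 : (0 : ℝ) < (R / 2) ^ k := by positivity
  exact (le_div_iff₀ hR2).1 (le_of_mul_le_mul_left h hk)

/-- **Geometric series**: if `‖coeff_k (taylor c q)‖ · r^k ≤ C` for all `k`, then `‖q(z)‖ ≤ 2C` on
the disc `B(c, r/2)` (`q(z) = Σ_k coeff_k (taylor c q) (z - c)^k`, ratio `‖z - c‖/r < 1/2`). -/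
theorem norm_eval_le_of_taylor_coeff_bound {q : Polynomial ℂ} {c : ℂ} {r C : ℝ} (hr : 0 < r)
    (hC : ∀ k : ℕ, ‖(Polynomial.taylor c q).coeff k‖ * r ^ k ≤ C) {z : ℂ}
    (hz : z ∈ Metric.ball c (r / 2)) : ‖q.eval z‖ ≤ 2 * C := by
  have hC0 : 0 ≤ C := le_trans (by positivity) (hC 0)
  have hzc : ‖z - c‖ < r / 2 := by rwa [Metric.mem_ball, dist_eq_norm] at hz
  rw [← Polynomial.taylor_eval_sub c q z, Polynomial.eval_eq_sum_range]
  calc ‖∑ i ∈ Finset.range ((Polynomial.taylor c q).natDegree + 1),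
          (Polynomial.taylor c q).coeff i * (z - c) ^ i‖
      ≤ ∑ i ∈ Finset.range ((Polynomial.taylor c q).natDegree + 1),
          ‖(Polynomial.taylor c q).coeff i * (z - c) ^ i‖ := norm_sum_le _ _
    _ ≤ ∑ i ∈ Finset.range ((Polynomial.taylor c q).natDegree + 1), C * (1 / 2) ^ i := by
        refine Finset.sum_le_sum fun i _ => ?_
        rw [norm_mul, norm_pow]
        calc ‖(Polynomial.taylor c q).coeff i‖ * ‖z - c‖ ^ i
            ≤ ‖(Polynomial.taylor c q).coeff i‖ * (r / 2) ^ i :=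
              mul_le_mul_of_nonneg_left (pow_le_pow_left₀ (norm_nonneg _) hzc.le i)
                (norm_nonneg _)
          _ = ‖(Polynomial.taylor c q).coeff i‖ * r ^ i * (1 / 2) ^ i := by
              rw [mul_assoc, ← mul_pow]; ring_nf
          _ ≤ C * (1 / 2) ^ i := mul_le_mul_of_nonneg_right (hC i) (by positivity)
    _ = C * ∑ i ∈ Finset.range ((Polynomial.taylor c q).natDegree + 1), (1 / 2 : ℝ) ^ i := by
        rw [Finset.mul_sum]
    _ ≤ C * 2 := mul_le_mul_of_nonneg_left (sum_geometric_two_le _) hC0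
    _ = 2 * C := mul_comm _ _

/-- **Cauchy's estimate for the first real derivative**: if the complex polynomial `p.map ι` is
bounded by `C` on `B(t₀, r)` and `|t - t₀| < r/2`, then `|p'(t)| ≤ 2C/(r/2)` (the disc
`B(t, r/2)` lies in `B(t₀, r)`). -/
theorem abs_derivative_eval_le {p : Polynomial ℝ} {t₀ t r C : ℝ} (hr : 0 < r)
    (hC : ∀ z ∈ Metric.ball ((t₀ : ℝ) : ℂ) r, ‖(p.map (algebraMap ℝ ℂ)).eval z‖ ≤ C)
    (ht : |t - t₀| < r / 2) : |p.derivative.eval t| ≤ 2 * C / (r / 2) := by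
  -- the disc `B(t, r/2)` lies in `B(t₀, r)`
  have hsub : Metric.ball ((t : ℝ) : ℂ) (r / 2) ⊆ Metric.ball ((t₀ : ℝ) : ℂ) r := by
    intro z hz
    rw [Metric.mem_ball] at hz ⊢
    have htt₀ : dist ((t : ℝ) : ℂ) ((t₀ : ℝ) : ℂ) < r / 2 := by
      rw [Complex.dist_eq, ← Complex.ofReal_sub, Complex.norm_real, Real.norm_eq_abs]
      exact ht
    calc dist z ((t₀ : ℝ) : ℂ) ≤ dist z (t : ℂ) + dist ((t : ℝ) : ℂ) ((t₀ : ℝ) : ℂ) :=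
          dist_triangle _ _ _
      _ < r / 2 + r / 2 := add_lt_add hz htt₀
      _ = r := by ring
  have hd : DifferentiableOn ℂ (fun z => (p.map (algebraMap ℝ ℂ)).eval z)
      (Metric.ball ((t : ℝ) : ℂ) (r / 2)) :=
    (Polynomial.differentiable _).differentiableOn
  have h := Literature.Analysis.Complex.norm_deriv_le_of_forall_mem_ball (half_pos hr) hd
    fun z hz => hC z (hsub hz)
  -- `(p'.map ι)(t) = ι (p' t)` at the real point `t`
  have hev : (p.derivative.map (algebraMap ℝ ℂ)).eval (t : ℂ) =
      ((p.derivative.eval t : ℝ) : ℂ) := by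
    rw [Polynomial.eval_map, ← Complex.coe_algebraMap, Polynomial.eval₂_hom]
  rw [Polynomial.deriv, Polynomial.derivative_map, hev, Complex.norm_real, Real.norm_eq_abs] at h
  exact h

open Summit.CriticalPhenomena.CardyFormulaZ2.Cruxes.UniformMarginality.HeatFlow in
/-- On `(0,1)` the extended crossing curve `Pext R δ` IS the crossing polynomial of S1, so its
derivative there is the derivative of the polynomial. -/
theorem deriv_Pext_eq {R : ConformalRectangle} {δ : ℝ} {p : Polynomial ℝ}
    (hp : ∀ t : unitInterval, Percolation.cornerCrossingProb t R δ = p.eval (t : ℝ)) {t : ℝ}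
    (ht : t ∈ Set.Ioo (0 : ℝ) 1) : deriv (Pext R δ) t = p.derivative.eval t := by
  have heq : Pext R δ =ᶠ[𝓝 t] fun s => p.eval s := by
    filter_upwards [isOpen_Ioo.mem_nhds ht] with s hs
    show Percolation.cornerCrossingProb (Set.projIcc (0 : ℝ) 1 zero_le_one s) R δ = p.eval s
    rw [hp, Set.projIcc_of_mem zero_le_one (Set.Ioo_subset_Icc_self hs)]
  rw [heq.deriv_eq, Polynomial.deriv]

end LocalComplexBound

open LocalComplexBound

/-- **NECESSITY (Cauchy's estimate; census link for S4w).**  Assume S4w (hypothesis, verbatim the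
registered stub `stub_localComplexBound`; NOT claimed).  Then for every `t₀ ∈ [0,1]` and every
conformal rectangle `R` there are `r > 0`, a mesh threshold `δ₁ > 0` and `C` such that for all
meshes `δ < δ₁` ALL Taylor coefficients at `t₀` of the complex crossing polynomial decay
geometrically, UNIFORMLY IN THE MESH: `‖coeff_k (taylor t₀ p_δ)‖ · r^k ≤ C` for every `k`
(with `r` = half the stub's radius).  `coeff_k (taylor t₀ p_δ) = p_δ^{(k)}(t₀)/k!` is the signed
level-`k` Fourier–Walsh (pivotal) sum of the coin-averaged crossing function at `t₀`; `k = 1` is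
`∂_t P_t(R, δ)|_{t₀}`, whose δ-uniform boundedness is the open Russo bound of crux 5472. -/
theorem russoCoeffBound_of_localComplexBound :
    (∀ (t₀ : unitInterval) (R : ConformalRectangle), ∃ r > 0, ∃ δ₁ > 0, ∃ C : ℝ, ∀ δ : ℝ,
      0 < δ → δ < δ₁ → ∀ p : Polynomial ℝ,
        (∀ t : unitInterval, Percolation.cornerCrossingProb t R δ = p.eval (t : ℝ)) →
        ∀ z ∈ Metric.ball ((t₀ : ℝ) : ℂ) r, ‖(p.map (algebraMap ℝ ℂ)).eval z‖ ≤ C) →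
    ∀ (t₀ : unitInterval) (R : ConformalRectangle), ∃ r > 0, ∃ δ₁ > 0, ∃ C : ℝ, ∀ δ : ℝ,
      0 < δ → δ < δ₁ → ∀ p : Polynomial ℝ,
        (∀ t : unitInterval, Percolation.cornerCrossingProb t R δ = p.eval (t : ℝ)) →
        ∀ k : ℕ, ‖((p.map (algebraMap ℝ ℂ)).taylor ((t₀ : ℝ) : ℂ)).coeff k‖ * r ^ k ≤ C := by
  intro h t₀ R
  obtain ⟨r, hr, δ₁, hδ₁, C, hC⟩ := h t₀ R
  exact ⟨r / 2, half_pos hr, δ₁, hδ₁, C, fun δ hδ hδ₁' p hp k =>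
    norm_taylor_coeff_mul_pow_le hr (hC δ hδ hδ₁' p hp) k⟩

/-- **SUFFICIENCY (geometric series; the converse census link).**  The coefficient form — δ-uniform
geometric decay `‖coeff_k (taylor t₀ p_δ)‖ · r^k ≤ C` of all Taylor coefficients at `t₀`, for the
meshes `δ < δ₁` ("LevelSumGeometricBound" at `(t₀, R)`) — implies S4w at `(t₀, R)` with radius
`r/2` and bound `2C`.  Together with `russoCoeffBound_of_localComplexBound`: S4w is EQUIVALENT to
its coefficient form, pointwise in `(t₀, R)`. -/
theorem localComplexBound_of_russoCoeffBound :
    (∀ (t₀ : unitInterval) (R : ConformalRectangle), ∃ r > 0, ∃ δ₁ > 0, ∃ C : ℝ, ∀ δ : ℝ,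
      0 < δ → δ < δ₁ → ∀ p : Polynomial ℝ,
        (∀ t : unitInterval, Percolation.cornerCrossingProb t R δ = p.eval (t : ℝ)) →
        ∀ k : ℕ, ‖((p.map (algebraMap ℝ ℂ)).taylor ((t₀ : ℝ) : ℂ)).coeff k‖ * r ^ k ≤ C) →
    ∀ (t₀ : unitInterval) (R : ConformalRectangle), ∃ r > 0, ∃ δ₁ > 0, ∃ C : ℝ, ∀ δ : ℝ,
      0 < δ → δ < δ₁ → ∀ p : Polynomial ℝ,
        (∀ t : unitInterval, Percolation.cornerCrossingProb t R δ = p.eval (t : ℝ)) →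
        ∀ z ∈ Metric.ball ((t₀ : ℝ) : ℂ) r, ‖(p.map (algebraMap ℝ ℂ)).eval z‖ ≤ C := by
  intro h t₀ R
  obtain ⟨r, hr, δ₁, hδ₁, C, hC⟩ := h t₀ R
  exact ⟨r / 2, half_pos hr, δ₁, hδ₁, 2 * C, fun δ hδ hδ₁' p hp z hz =>
    norm_eval_le_of_taylor_coeff_bound hr (hC δ hδ hδ₁' p hp) hz⟩

open Summit.CriticalPhenomena.CardyFormulaZ2.Cruxes.UniformMarginality.HeatFlow in
/-- **LEVEL ONE: S4w ⊢ `RussoBound` (the open research stub B of crux `UniformMarginality`,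
stmt-CriticalPhenomena-5472).**  Assume S4w (hypothesis, verbatim the registered stub; NOT
claimed).  Fix `R` and `t₀ ∈ [0,1]`, and let `r, δ₁, C` be the data of S4w at `(t₀, R)`.  For a
mesh `δ < δ₁` and `t ∈ (0,1)` with `|t - t₀| < r/2`, `Pext R δ` agrees near `t` with S1's crossing
polynomial `p_δ` (`stub_crossingProbPolynomial`, landed), and Cauchy's estimate on
`B(t, r/2) ⊆ B(t₀, r)` bounds `|p_δ'(t)| ≤ 4C/r`; for `δ ≥ δ₁` the landed `russoBound_largeMesh`
bounds the Russo sum by a constant `C'(R, δ₁)`.  Hence `|∂_t P_t(R, δ)| ≤ max (4C/r) C'` for all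
`δ > 0`: `RussoBoundAt R` at `t₀`, for every `R` and `t₀`. -/
theorem russoBound_of_localComplexBound :
    (∀ (t₀ : unitInterval) (R : ConformalRectangle), ∃ r > 0, ∃ δ₁ > 0, ∃ C : ℝ, ∀ δ : ℝ,
      0 < δ → δ < δ₁ → ∀ p : Polynomial ℝ,
        (∀ t : unitInterval, Percolation.cornerCrossingProb t R δ = p.eval (t : ℝ)) →
        ∀ z ∈ Metric.ball ((t₀ : ℝ) : ℂ) r, ‖(p.map (algebraMap ℝ ℂ)).eval z‖ ≤ C) →
    Summit.CriticalPhenomena.CardyFormulaZ2.Cruxes.UniformMarginality.HeatFlow.RussoBound := by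
  intro h R t₀ ht₀
  obtain ⟨r, hr, δ₁, hδ₁, C, hC⟩ := h ⟨t₀, ht₀⟩ R
  obtain ⟨C', hC'⟩ := russoBound_largeMesh R δ₁ hδ₁
  refine ⟨r / 2, half_pos hr, max (2 * C / (r / 2)) C', fun δ hδ t ht htt₀ => ?_⟩
  rcases lt_or_ge δ δ₁ with hlt | hle
  · -- small mesh: Cauchy's estimate for S1's crossing polynomial
    obtain ⟨p, hp⟩ := stub_crossingProbPolynomial R δ hδ
    rw [deriv_Pext_eq hp ht]
    exact (abs_derivative_eval_le hr (hC δ hδ hlt p hp) htt₀).trans (le_max_left _ _)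
  · -- large mesh: finitely many Russo terms of modulus `≤ 1`
    exact (hC' δ hle t ht).trans (le_max_right _ _)

open Summit.CriticalPhenomena.CardyFormulaZ2.Cruxes.UniformMarginality.HeatFlow in
/-- **S4w ⊢ the route decl `UniformMarginality` (crux stmt-CriticalPhenomena-5472).**  By
`russoBound_of_localComplexBound` and the landed heat-flow glue of line `Sketch` of crux 5472
(`integratedBound_of` with `stub_russoIdentity`, `stub_pextContinuous`; then
`uniformMarginality_of_integratedBound`).  Reshape-7 update of the reshape-6 record S4s ⊢ UM
(p131349): the POINTWISE complex bound already proves the crux hypothesis of `SegmentOpen`. -/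
theorem uniformMarginality_of_localComplexBound :
    (∀ (t₀ : unitInterval) (R : ConformalRectangle), ∃ r > 0, ∃ δ₁ > 0, ∃ C : ℝ, ∀ δ : ℝ,
      0 < δ → δ < δ₁ → ∀ p : Polynomial ℝ,
        (∀ t : unitInterval, Percolation.cornerCrossingProb t R δ = p.eval (t : ℝ)) →
        ∀ z ∈ Metric.ball ((t₀ : ℝ) : ℂ) r, ‖(p.map (algebraMap ℝ ℂ)).eval z‖ ≤ C) →
    Summit.CriticalPhenomena.CardyFormulaZ2.Theses.CardySelfDualSegment.UniformMarginality :=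
  fun h => uniformMarginality_of_integratedBound
    (integratedBound_of stub_russoIdentity stub_pextContinuous (russoBound_of_localComplexBound h))

end Summit.CriticalPhenomena.CardyFormulaZ2.Theorems
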